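import Summits.CriticalPhenomena.PercolationContinuityZ3.Theorems.PercNearOneGluingNoHeavyLowerTailSahiLatinTerminalSupport

/-!
# `NoHeavyLowerTail` (crux stmt-CriticalPhenomena-4575), Sahi programme (prim-master-conj gen 44): the two DIMENSION-STABLE SLACK BOUNDS at A-closed triples
# (typed conjectures, exhaustive for `d ≤ 4`) and their consequence TZ′ ⟹ TZ

Support file (`--supports stmt-CriticalPhenomena-4575`; companion of `…SahiLatinSlack`, `…SahiLatinTerminalSupport`).  Memo
`run/shared/lean/prim/prim-l12/FROM-prim-master-conj-g44-SLACK-CALCULUS.md` §0 (D); POINTWISE §45.  The two bounds are typed `Prop`s, NEVER asserted; the implications are proved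
(standard axioms, no FBP).

* CONJECTURE (★7) `AClosedHalfMinSlack ι`: at every A-closed triple of nonempty proper up-sets of `[3]^ι`,
  `min{HS(a,b∩c), HS(b,a∩c), HS(c,a∩b)} ≤ 2·κ(a,b,c)`.  Evidence: `d = 3` exhaustive over all 40 266 A-closed proper ordered triples, `d = 4` exhaustive over all terminal
  triples (kit j261203/205/209/215), `d = 5` adversarial sampling; tight at the triangle `{x_i = 2 ∨ x_j = 2}` (`κ = 8`, mixed slacks `16`).
* CONJECTURE (★5) `AClosedQuarterMinPairSlack ι`: same hypotheses, `min{HS(a,b), HS(a,c), HS(b,c)} ≤ 4·κ(a,b,c)` (same evidence; tight at the same triangle, pair slacks `32`).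
* `aclosedZerosIndep_of_halfMinSlack`, `aclosedZerosIndep_of_quarterMinPairSlack`: **either bound implies TZ′** (hence TZ, `terminalZerosIndep_of_aclosedZerosIndep`): at a zero the
  minimum is `≤ 0`, slacks of up-sets are `≥ 0` (`HS_nonneg`), so one slack vanishes; a vanishing mixed slack gives two independent pairs (`AClosed.HS_inter_eq_zero_iff`), a
  vanishing pair slack one (`HS_eq_zero_iff_indep`), and one independent pair gives all three (`indep_all_of_aclosed_zero_of_indepPair`).
HONEST LABEL: (★7), (★5), TZ′, TZ, FBP (`d ≥ 5`) are OPEN.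
-/

namespace Summit.CriticalPhenomena.PercolationContinuityZ3.Theorems.SahiLatin

open Finset

variable {ι : Type*} [Fintype ι] [DecidableEq ι]

/-- **CONJECTURE (★7)** (prim-master-conj gen 44; typed, NEVER asserted): at an A-closed triple of nonempty proper up-sets the smallest MIXED slack is at most `2κ`:
`min{HS(a,b∩c), HS(b,a∩c), HS(c,a∩b)} ≤ 2·κ(a,b,c)`.  Exhaustive for `d ≤ 4`; tight at the triangle.  An obligation / hypothesis, never a fact. [this work] [status: open] -/
@[conjecture] def AClosedHalfMinSlack (ι : Type*) [Fintype ι] [DecidableEq ι] : Prop :=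
  ∀ a b c : Finset (Pt ι), UpTriple a b c → a.Nonempty → a ≠ univ → b.Nonempty → b ≠ univ → c.Nonempty → c ≠ univ → AClosed a b c →
    min (HS a (b ∩ c)) (min (HS b (a ∩ c)) (HS c (a ∩ b))) ≤ 2 * kappa a b c

/-- **CONJECTURE (★5)** (prim-master-conj gen 44; typed, NEVER asserted): at an A-closed triple of nonempty proper up-sets the smallest PAIR slack is at most `4κ`:
`min{HS(a,b), HS(a,c), HS(b,c)} ≤ 4·κ(a,b,c)`.  Exhaustive for `d ≤ 4`; tight at the triangle.  An obligation / hypothesis, never a fact. [this work] [status: open] -/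
@[conjecture] def AClosedQuarterMinPairSlack (ι : Type*) [Fintype ι] [DecidableEq ι] : Prop :=
  ∀ a b c : Finset (Pt ι), UpTriple a b c → a.Nonempty → a ≠ univ → b.Nonempty → b ≠ univ → c.Nonempty → c ≠ univ → AClosed a b c →
    min (HS a b) (min (HS a c) (HS b c)) ≤ 4 * kappa a b c

/-- At an A-closed zero of up-sets, a vanishing mixed slack in ANY slot gives pairwise independence. [this work] -/
theorem indep_all_of_aclosed_zero_of_HS_inter_eq_zero {a b c : Finset (Pt ι)} (hup : UpTriple a b c) (hA : AClosed a b c) (h0 : kappa a b c = 0)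
    (h : HS a (b ∩ c) = 0 ∨ HS b (a ∩ c) = 0 ∨ HS c (a ∩ b) = 0) : Indep a b ∧ Indep a c ∧ Indep b c := by
  refine indep_all_of_aclosed_zero_of_indepPair hup hA h0 ?_
  rcases h with h1 | h2 | h3
  · exact Or.inl ((hA.HS_inter_eq_zero_iff hup).1 h1).1
  · exact Or.inl ((hA.swap12.HS_inter_eq_zero_iff hup.swap12).1 h2).1.symm
  · exact Or.inr (Or.inl ((hA.swap23.swap12.HS_inter_eq_zero_iff hup.swap23.swap12).1 h3).1.symm)

/-- **(★7) ⟹ TZ′.** [this work] -/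
theorem aclosedZerosIndep_of_halfMinSlack (h : AClosedHalfMinSlack ι) : AClosedZerosIndep ι := by
  intro a b c hup ha ha' hb hb' hc hc' hA h0
  have hm := h a b c hup ha ha' hb hb' hc hc' hA
  rw [h0, mul_zero] at hm
  have hbc : IsUpperSet ((b ∩ c : Finset (Pt ι)) : Set (Pt ι)) := by rw [coe_inter]; exact hup.2.1.inter hup.2.2
  have hac : IsUpperSet ((a ∩ c : Finset (Pt ι)) : Set (Pt ι)) := by rw [coe_inter]; exact hup.1.inter hup.2.2
  have hab : IsUpperSet ((a ∩ b : Finset (Pt ι)) : Set (Pt ι)) := by rw [coe_inter]; exact hup.1.inter hup.2.1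
  have h1 := HS_nonneg hup.1 hbc
  have h2 := HS_nonneg hup.2.1 hac
  have h3 := HS_nonneg hup.2.2 hab
  refine indep_all_of_aclosed_zero_of_HS_inter_eq_zero hup hA h0 ?_
  rcases le_total (HS a (b ∩ c)) (min (HS b (a ∩ c)) (HS c (a ∩ b))) with hle | hle
  · rw [min_eq_left hle] at hm
    exact Or.inl (le_antisymm hm h1)
  · rw [min_eq_right hle] at hm
    rcases le_total (HS b (a ∩ c)) (HS c (a ∩ b)) with hle' | hle'
    · rw [min_eq_left hle'] at hm
      exact Or.inr (Or.inl (le_antisymm hm h2))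
    · rw [min_eq_right hle'] at hm
      exact Or.inr (Or.inr (le_antisymm hm h3))

/-- **(★5) ⟹ TZ′.** [this work] -/
theorem aclosedZerosIndep_of_quarterMinPairSlack (h : AClosedQuarterMinPairSlack ι) : AClosedZerosIndep ι := by
  intro a b c hup ha ha' hb hb' hc hc' hA h0
  have hm := h a b c hup ha ha' hb hb' hc hc' hA
  rw [h0, mul_zero] at hm
  have h1 := HS_nonneg hup.1 hup.2.1
  have h2 := HS_nonneg hup.1 hup.2.2
  have h3 := HS_nonneg hup.2.1 hup.2.2
  refine indep_all_of_aclosed_zero_of_indepPair hup hA h0 ?_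
  rcases le_total (HS a b) (min (HS a c) (HS b c)) with hle | hle
  · rw [min_eq_left hle] at hm
    exact Or.inl ((HS_eq_zero_iff_indep hup.1 hup.2.1).1 (le_antisymm hm h1))
  · rw [min_eq_right hle] at hm
    rcases le_total (HS a c) (HS b c) with hle' | hle'
    · rw [min_eq_left hle'] at hm
      exact Or.inr (Or.inl ((HS_eq_zero_iff_indep hup.1 hup.2.2).1 (le_antisymm hm h2)))
    · rw [min_eq_right hle'] at hm
      exact Or.inr (Or.inr ((HS_eq_zero_iff_indep hup.2.1 hup.2.2).1 (le_antisymm hm h3)))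

/-- Hence (★7) ⟹ TZ. [this work] -/
theorem terminalZerosIndep_of_halfMinSlack (h : AClosedHalfMinSlack ι) : TerminalZerosIndep ι :=
  terminalZerosIndep_of_aclosedZerosIndep (aclosedZerosIndep_of_halfMinSlack h)

/-- Hence (★5) ⟹ TZ. [this work] -/
theorem terminalZerosIndep_of_quarterMinPairSlack (h : AClosedQuarterMinPairSlack ι) : TerminalZerosIndep ι :=
  terminalZerosIndep_of_aclosedZerosIndep (aclosedZerosIndep_of_quarterMinPairSlack h)

end Summit.CriticalPhenomena.PercolationContinuityZ3.Theorems.SahiLatin
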